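import Summits.ValiantsHypothesis.ValiantsHypothesis.Theorems.GrenetZeonDualUnipotentThreeHalvesHeavyTopThmCKillS1
import Summits.ValiantsHypothesis.ValiantsHypothesis.Theorems.GrenetZeonDualUnipotentThreeHalvesHeavyTopThmCKillS2
import Summits.ValiantsHypothesis.ValiantsHypothesis.Theorems.GrenetZeonDualUnipotentThreeHalvesHeavyTopThmCKillS3
import Summits.ValiantsHypothesis.ValiantsHypothesis.Theorems.GrenetZeonDualUnipotentThreeHalvesHeavyTopThmCKillS4
import Summits.ValiantsHypothesis.ValiantsHypothesis.Theorems.GrenetZeonDualUnipotentThreeHalvesHeavyTopThmCKillS5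
import Summits.ValiantsHypothesis.ValiantsHypothesis.Theorems.GrenetZeonDualUnipotentThreeHalvesHeavyTopThmCWindowDot
import Summits.ValiantsHypothesis.ValiantsHypothesis.Theorems.GrenetZeonDualUnipotentThreeHalvesHeavyTopThmCStructure
import Summits.ValiantsHypothesis.ValiantsHypothesis.Theorems.GrenetZeonDualUnipotentThreeHalvesHeavyTopThmCRegularShift
import Summits.ValiantsHypothesis.ValiantsHypothesis.Theorems.GrenetZeonDualUnipotentThreeHalvesHeavyTopTorusInitial
import Summits.ValiantsHypothesis.ValiantsHypothesis.Theorems.GrenetZeonDualUnipotentThreeHalvesHeavyTopConjTransport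
import Summits.ValiantsHypothesis.ValiantsHypothesis.Theorems.GrenetZeonDualUnipotentThreeHalvesHeavyTopIotaOfThmC

/-!
# `GrenetZeon.DualUnipotentThreeHalves` (stmt-ValiantsHypothesis-24318), R2 heavy-top instrument — ★★★ THEOREM C(7) IN THE KERNEL,
# and the census row `(5,7)`: `HeavyTopInst 5 7` UNCONDITIONALLY

Experiment cell «val-heavytop-census» (D-0160), engine seat val-htc-eng-1 g4.  THEOREM C(7) (lead g0 `ROADMAP-codim1.md` §1–§6, lead-g2 `THMC-CHECK.md`):
a linear space `V ≤ M₇(ℂ)` of nilpotent matrices with `dim V = 20` containing a regular nilpotent (`Z^6 ≠ 0`) has a non-trivial proper invariant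
subspace.  With ✓ `HeavyTopIotaOfThmC.heavyTopInst_five_seven_of_thmC7` (whose hypothesis is literally this statement) the census instance
`HeavyTopInst 5 7` follows with NO hypothesis — the cell's `(5,7)` row passes from ✓ʰ (hand/machine) to ✓ KERNEL.

PROOF (kernel port by COUNT + CERTIFICATES, replacing the pencil framework): conjugate the regular element to the shift `J` (✓ `…ThmCRegularShift`,
✓ `HeavyTopConjTransport`); graded limit `W` along `diag(t^6,…,t^0)` (✓ `HeavyTopTorusInitial`); trace-orthogonality count (✓ `…ThmCGradedCount`) ⇒ all
heights but at most one `h*` are non-deficient; letters `J^h`, `E_{ij}` (`j − i > s`, `≠ h*`), `C̃_c` in `W` (✓ `…ThmCStructure`, ✓ `…ThmCWindow`, ✓ `…ThmCWindowDot`);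
`s :=` lowest weight of `W`; `s = 0` ⇒ `ℂe₀` invariant; `s ≥ 2` ⇒ `N_s = 0` by the dispatchers ✓ `…ThmCKillS*` (probe traces ✓ `…ThmCProbesS*`,
Nullstellensatz certificates ✓ `…ThmCCertsS*`), contradiction; `s = 1` ⇒ `q₀q₂ = 0` on `N_1` ⇒ `span(e₀)` or `span(e₀,e₁,e₂)` invariant.

* ★★ `thmC7_shift` — the theorem for `V ∋ J`;  ★★★ `thmC7` — Theorem C(7) in the hypothesis shape of ✓ `heavyTopInst_five_seven_of_thmC7`;
* ★★★ `heavyTopInst_five_seven : HeavyTopInst 5 7` — the census cell `(5,7)` is TRUE, kernel-checked, no hypothesis; `iota_seven_le_nineteen` — `ι(7) ≤ 19`.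

Honest framing: `HeavyTopInst 5 7` is ONE instance (`n = 5`, `m = 7`, `C₀ = 1` sliver) of R2 `HeavyTopLaw`; nothing here proves or refutes
`HeavyTopLaw`/`HeavyTopSlowLaw` themselves, 24318, S3 or 8062; census = calibration; `VP ≠ VNP` is NOT proved.  No definitions.  [this seat]
-/

noncomputable section

-- single-conjunct layout: Sub = Summit, duplicated namespace component intended
set_option linter.dupNamespace false
set_option linter.unusedSimpArgs false
set_option linter.unnecessarySeqFocus false
set_option linter.unreachableTactic false
set_option linter.unusedTactic false

namespace Summit.ValiantsHypothesis.ValiantsHypothesis.Theorems.GrenetZeon.HeavyTopThmCSeven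

open Matrix
open Summit.ValiantsHypothesis.ValiantsHypothesis.Theorems.GrenetZeon.HeavyTopThmCTraceKit (forall_eq_zero_or_of_mul_eq_zero trace_mixed_eq_zero_of_mem)
open Summit.ValiantsHypothesis.ValiantsHypothesis.Theorems.GrenetZeon.HeavyTopThmCGradedCount (dot_eq_zero dot_one_eq_zero finrank_add_le finrank_add_succ_le finrank_le_sum)
open Summit.ValiantsHypothesis.ValiantsHypothesis.Theorems.GrenetZeon.HeavyTopThmCStructure (jpow_mem unit_mem lower_band_mem map_eq_top_of_finrank mem_of_dot_eq_zero below_of_initial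
  not_irreducible_of_column_strip)
open Summit.ValiantsHypothesis.ValiantsHypothesis.Theorems.GrenetZeon.HeavyTopThmCWindow (window_2 window_3 window_4 window_5)
open Summit.ValiantsHypothesis.ValiantsHypothesis.Theorems.GrenetZeon.HeavyTopThmCWindowDot (polyDot_2 polyDot_3 polyDot_4 polyDot_5)
open Summit.ValiantsHypothesis.ValiantsHypothesis.Theorems.GrenetZeon.HeavyTopThmCRegularShift (exists_isUnit_conj_eq_fullShift)
open Summit.ValiantsHypothesis.ValiantsHypothesis.Theorems.GrenetZeon.HeavyTopTorusInitial (exists_torus_initial_subspace_of_isNilpotent pow_eq_zero_of_isNilpotent)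
open Summit.ValiantsHypothesis.ValiantsHypothesis.Theorems.GrenetZeon.HeavyTopConjTransport (exists_conj_subspace not_irreducible_of_conj)
open Summit.ValiantsHypothesis.ValiantsHypothesis.Theorems.GrenetZeon.HeavyTopIotaOfThmC (heavyTopInst_five_seven_of_thmC7 iota7_of_thmC7)
open Summit.ValiantsHypothesis.ValiantsHypothesis.Theorems.GrenetZeon.RadicalSplit (HeavyTopInst)


/-! ## Theorem C(7) with the shift inside -/

/-- ★★ **Theorem C(7), normalised form.**  A `20`-dimensional linear space of nilpotent `7 × 7` matrices containing the shift `J` has a non-trivial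
proper invariant subspace. [lead g0 ROADMAP-codim1 Thm C (m = 7); this seat (kernel port by count + certificates)] -/
theorem thmC7_shift (V : Submodule ℂ (Matrix (Fin 7) (Fin 7) ℂ)) (hV : ∀ A ∈ V, IsNilpotent A) (hdim : Module.finrank ℂ V = 20)
    (hJV : (Matrix.of fun a b : Fin 7 => if (b : ℕ) = (a : ℕ) + 1 then (1 : ℂ) else 0) ∈ V) :
    ¬ ∀ U : Submodule ℂ (Fin 7 → ℂ), (∀ A ∈ V, ∀ x ∈ U, A *ᵥ x ∈ U) → U = ⊥ ∨ U = ⊤ := by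
  classical
  -- the graded limit along `diag(t^6, …, t^0)`
  obtain ⟨W, hWdim, hWgr', hWinit', -, hWnil, -⟩ := exists_torus_initial_subspace_of_isNilpotent (fun a : Fin 7 => 6 - (a : ℕ)) V hV
  have projEq : ∀ (A : Matrix (Fin 7) (Fin 7) ℂ) (d : ℤ),
      (Matrix.of fun a b : Fin 7 => if (b : ℤ) - (a : ℤ) = d then A a b else 0) =
      (Matrix.of fun a b : Fin 7 => if (((fun a : Fin 7 => 6 - (a : ℕ)) a : ℕ) : ℤ) - (((fun a : Fin 7 => 6 - (a : ℕ)) b : ℕ) : ℤ) = d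
        then A a b else 0) := by
    intro A d; ext a b; simp only [Matrix.of_apply]
    split_ifs with h1 h2 h2 <;> first | rfl | (exfalso; omega)
  have hgr : ∀ A ∈ W, ∀ d : ℤ, (Matrix.of fun a b : Fin 7 => if (b : ℤ) - (a : ℤ) = d then A a b else 0) ∈ W := by
    intro A hA d; rw [projEq]; exact hWgr' A hA d
  have hinit : ∀ Z ∈ V, ∀ d : ℤ, (∀ a b : Fin 7, (b : ℤ) - (a : ℤ) < d → Z a b = 0) →
      (Matrix.of fun a b : Fin 7 => if (b : ℤ) - (a : ℤ) = d then Z a b else 0) ∈ W := by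
    intro Z hZ d hlow; rw [projEq]
    exact hWinit' Z hZ d (fun a b hab => hlow a b (by omega))
  -- `J ∈ W`
  have hJW : (Matrix.of fun a b : Fin 7 => if (b : ℕ) = (a : ℕ) + 1 then (1 : ℂ) else 0) ∈ W := by
    have h1 := hinit _ hJV 1 (fun a b hab => by rw [Matrix.of_apply, if_neg]; omega)
    have e : (Matrix.of fun a b : Fin 7 => if (b : ℤ) - (a : ℤ) = (1 : ℤ) then (Matrix.of fun a b : Fin 7 => if (b : ℕ) = (a : ℕ) + 1 then (1 : ℂ) else 0) a b else 0) =
        (Matrix.of fun a b : Fin 7 => if (b : ℕ) = (a : ℕ) + 1 then (1 : ℂ) else 0) := by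
      ext a b; simp only [Matrix.of_apply]
      by_cases hb : (b : ℕ) = (a : ℕ) + 1
      · rw [if_pos (by omega), if_pos hb]
      · rw [if_neg hb]; split_ifs <;> rfl
    rw [e] at h1; exact h1
  -- the diagonal-extraction maps
  let dp : ∀ h : ℕ, Matrix (Fin 7) (Fin 7) ℂ →ₗ[ℂ] (Fin (7 - h) → ℂ) := fun h =>
    LinearMap.pi fun i : Fin (7 - h) => Matrix.entryLinearMap ℂ ℂ (⟨(i : ℕ), by omega⟩ : Fin 7) (⟨(i : ℕ) + h, by omega⟩ : Fin 7)
  let dm : ∀ h : ℕ, Matrix (Fin 7) (Fin 7) ℂ →ₗ[ℂ] (Fin (7 - h) → ℂ) := fun h =>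
    LinearMap.pi fun i : Fin (7 - h) => Matrix.entryLinearMap ℂ ℂ (⟨(i : ℕ) + h, by omega⟩ : Fin 7) (⟨(i : ℕ), by omega⟩ : Fin 7)
  have hdp : ∀ h A (i : Fin (7 - h)) (a b : Fin 7), (a : ℕ) = i → (b : ℕ) = i + h → dp h A i = A a b := by
    intro h A i a b ha hb
    obtain ⟨a, ha'⟩ := a
    obtain ⟨b, hb'⟩ := b
    simp only at ha hb
    subst ha; subst hb; rfl
  have hdm : ∀ h A (i : Fin (7 - h)) (a b : Fin 7), (a : ℕ) = i + h → (b : ℕ) = i → dm h A i = A a b := by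
    intro h A i a b ha hb
    obtain ⟨a, ha'⟩ := a
    obtain ⟨b, hb'⟩ := b
    simp only at ha hb
    subst ha; subst hb; rfl
  -- orthogonality, sums, bounds, count
  have hPN : ∀ h, ∀ q ∈ W.map (dm h), ∀ p ∈ W.map (dp h), q ⬝ᵥ p = 0 :=
    fun h => dot_eq_zero W hWnil hgr h (dp h) (dm h) (hdp h) (hdm h)
  have hN1 : ∀ h, ∀ q ∈ W.map (dm h), q ⬝ᵥ (fun _ => (1 : ℂ)) = 0 :=
    fun h => dot_one_eq_zero W hWnil hgr hJW h (dm h) (hdm h)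
  have hb : ∀ h, Module.finrank ℂ (W.map (dp h)) + Module.finrank ℂ (W.map (dm h)) ≤ 7 - h :=
    fun h => finrank_add_le h _ _ (hPN h)
  have hb' : ∀ h, (fun _ => (1 : ℂ)) ∉ W.map (dp h) →
      Module.finrank ℂ (W.map (dp h)) + Module.finrank ℂ (W.map (dm h)) + 1 ≤ 7 - h :=
    fun h hone => finrank_add_succ_le h _ _ (hPN h) (hN1 h) hone
  have hcount := finrank_le_sum W hWnil hgr dp dm hdp hdm
  rw [hWdim, hdim] at hcount
  have hcount' : 20 ≤ Module.finrank ℂ (W.map (dp 1)) + Module.finrank ℂ (W.map (dm 1)) +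
      (Module.finrank ℂ (W.map (dp 2)) + Module.finrank ℂ (W.map (dm 2))) +
      (Module.finrank ℂ (W.map (dp 3)) + Module.finrank ℂ (W.map (dm 3))) +
      (Module.finrank ℂ (W.map (dp 4)) + Module.finrank ℂ (W.map (dm 4))) +
      (Module.finrank ℂ (W.map (dp 5)) + Module.finrank ℂ (W.map (dm 5))) +
      (Module.finrank ℂ (W.map (dp 6)) + Module.finrank ℂ (W.map (dm 6))) := by
    have h := hcount
    simp only [Fin.sum_univ_six] at h
    exact h
  -- the deficient height
  have key : ∃ hstar : ℕ, ∀ h : ℕ, 1 ≤ h → h ≤ 6 → h ≠ hstar →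
      (Module.finrank ℂ (W.map (dp h)) + Module.finrank ℂ (W.map (dm h)) = 7 - h ∧ (fun _ => (1 : ℂ)) ∈ W.map (dp h)) := by
    by_contra hcon
    push Not at hcon
    have slack : ∀ h, (Module.finrank ℂ (W.map (dp h)) + Module.finrank ℂ (W.map (dm h)) = 7 - h → (fun _ => (1 : ℂ)) ∉ W.map (dp h)) →
        Module.finrank ℂ (W.map (dp h)) + Module.finrank ℂ (W.map (dm h)) + 1 ≤ 7 - h := by
      intro h himp
      by_cases heq : Module.finrank ℂ (W.map (dp h)) + Module.finrank ℂ (W.map (dm h)) = 7 - h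
      · exact hb' h (himp heq)
      · have := hb h; omega
    obtain ⟨h₁, h11, h16, -, hbad1⟩ := hcon 0
    obtain ⟨h₂, h21, h26, hne, hbad2⟩ := hcon h₁
    have s1 := slack h₁ hbad1
    have s2 := slack h₂ hbad2
    have b1 := hb 1; have b2 := hb 2; have b3 := hb 3; have b4 := hb 4; have b5 := hb 5; have b6 := hb 6
    interval_cases h₁ <;> interval_cases h₂ <;> omega
  obtain ⟨hstar, key⟩ := key
  -- the lowest weight
  obtain ⟨s, hs⟩ : ∃ s, Nat.findGreatest (fun h => W.map (dm h) ≠ ⊥) 6 = s := ⟨_, rfl⟩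
  obtain ⟨hs6, hsP, hsmax⟩ := Nat.findGreatest_eq_iff.1 hs
  have hNabove : ∀ h, s < h → h ≤ 6 → W.map (dm h) = ⊥ := fun h h1 h2 => not_not.1 (hsmax h1 h2)
  have hbelow := below_of_initial V W hinit dm hdm s hNabove
  -- letters available below the deficient height
  have hJpow : ∀ h : ℕ, 2 ≤ h → h ≤ 6 → h ≠ hstar →
      (Matrix.of fun a b : Fin 7 => if (b : ℕ) = (a : ℕ) + h then (1 : ℂ) else 0) ∈ W :=
    fun h h2 h6 hne => jpow_mem W hgr h (dp h) (hdp h) (key h (by omega) h6 hne).2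
  have hUnit : ∀ i j : ℕ, j ≤ 6 → i + s < j → j ≠ i + hstar →
      (Matrix.of fun a b : Fin 7 => if (a : ℕ) = i ∧ (b : ℕ) = j then (1 : ℂ) else 0) ∈ W := by
    intro i j hj hij hne
    obtain ⟨gsum, -⟩ := key (j - i) (by omega) (by omega) (by omega)
    have hNbot : W.map (dm (j - i)) = ⊥ := hNabove (j - i) (by omega) (by omega)
    rw [hNbot, finrank_bot, add_zero] at gsum
    have hPtop : W.map (dp (j - i)) = ⊤ := map_eq_top_of_finrank (j - i) _ gsum
    have hmem : Pi.single (⟨i, by omega⟩ : Fin (7 - (j - i))) (1 : ℂ) ∈ W.map (dp (j - i)) := by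
      rw [hPtop]; exact Submodule.mem_top
    have h1 := unit_mem W hgr (j - i) (dp (j - i)) (hdp (j - i)) ⟨i, by omega⟩ hmem
    have e : (Matrix.of fun a b : Fin 7 => if (a : ℕ) = i ∧ (b : ℕ) = j then (1 : ℂ) else 0) =
        (Matrix.of fun a b : Fin 7 => if (a : ℕ) = ((⟨i, by omega⟩ : Fin (7 - (j - i))) : ℕ) ∧
          (b : ℕ) = ((⟨i, by omega⟩ : Fin (7 - (j - i))) : ℕ) + (j - i) then (1 : ℂ) else 0) := by
      ext a b; simp only [Matrix.of_apply, Fin.val_mk]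
      have hij' : i + (j - i) = j := by omega
      rw [hij']
    rw [e]; exact h1
  -- case split on the lowest weight
  rcases Nat.eq_zero_or_pos s with hs0 | hspos
  · -- `s = 0`: every member of `V` is upper triangular
    subst hs0
    exact not_irreducible_of_column_strip V 0 (by norm_num) (fun X hX a b hb0 ha => hbelow X hX a b (by omega))
  obtain ⟨x, hxN, hx0⟩ := (Submodule.ne_bot_iff _).1 (hsP (by omega))
  obtain ⟨B, hB, rfl⟩ := hxN
  have hs5 : s ≤ 5 := by
    by_contra hs5
    have hs6' : s = 6 := by omega
    subst hs6'
    apply hx0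
    funext i
    have h1 := hN1 6 _ ⟨B, hB, rfl⟩
    rw [dotProduct, Finset.sum_eq_single i (fun j _ hj => absurd (Fin.ext (by omega) : j = i) hj)
      (fun h => absurd (Finset.mem_univ i) h), mul_one] at h1
    exact h1

  interval_cases s
  · -- lowest weight s = 1: `q₀ q₂ = 0` on `N_1`, then an invariant flag piece
    have hprod : ∀ x ∈ W.map (dm 1),
        (LinearMap.proj (⟨0, by omega⟩ : Fin (7 - 1)) : (Fin (7 - 1) → ℂ) →ₗ[ℂ] ℂ) x *
          (LinearMap.proj (⟨2, by omega⟩ : Fin (7 - 1)) : (Fin (7 - 1) → ℂ) →ₗ[ℂ] ℂ) x = 0 := by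
      rintro _ ⟨B, hB, rfl⟩
      simp only [LinearMap.coe_proj, Function.eval]
      obtain ⟨c, hc⟩ : ∃ c : Fin 7 → ℂ, ∀ b : Fin 7, c b = if hb : (b : ℕ) < 7 - 1 then dm 1 B ⟨(b : ℕ), hb⟩ else 0 := ⟨_, fun _ => rfl⟩
      have hc' : ∀ i : Fin (7 - 1), c ⟨(i : ℕ), by omega⟩ = dm 1 B i := fun i => by rw [hc, dif_pos i.isLt]
      have hYc : (Matrix.of fun a b : Fin 7 => if (a : ℕ) = (b : ℕ) + 1 then c b else 0) ∈ W := lower_band_mem W hgr 1 (dm 1) (hdm 1) B hB c hc'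
      have hC : hstar ≠ 1 → (Matrix.of fun a b : Fin 7 => if (a : ℕ) = (b : ℕ) + 1 then (![c 0, c 1, c 2, c 3, c 4, c 5, 0] : Fin 7 → ℂ) b else 0) ∈ W := by
        intro _
        have e : (Matrix.of fun a b : Fin 7 => if (a : ℕ) = (b : ℕ) + 1 then (![c 0, c 1, c 2, c 3, c 4, c 5, 0] : Fin 7 → ℂ) b else 0) =
            (Matrix.of fun a b : Fin 7 => if (a : ℕ) = (b : ℕ) + 1 then c b else 0) := by
          ext a b
          simp only [Matrix.of_apply]
          by_cases hab : (a : ℕ) = (b : ℕ) + 1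
          · rw [if_pos hab, if_pos hab]
            have hb6 : (b : ℕ) < 6 := by omega
            fin_cases b <;> simp at hb6 ⊢
          · rw [if_neg hab, if_neg hab]
        rw [e]; exact hYc
      rcases Summit.ValiantsHypothesis.ValiantsHypothesis.Theorems.GrenetZeon.HeavyTopThmCKillS1.kill hstar W hWnil c hYc hJW hJpow hUnit hC with hz | ⟨-, h02⟩
      · have h0 := hz 0 (by norm_num)
        rw [hc, dif_pos (by norm_num)] at h0
        exact mul_eq_zero_of_left h0 _
      · have e0 : c 0 = dm 1 B ⟨0, by omega⟩ := by rw [hc, dif_pos (by norm_num)]; rfl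
        have e2 : c 2 = dm 1 B ⟨2, by omega⟩ := by rw [hc, dif_pos (by norm_num)]; rfl
        rw [e0, e2] at h02
        exact h02
    -- entries `X_{m+1,m}` of members of `V` are coordinates of weight-`(−1)` vectors of `W`
    have hentry : ∀ X ∈ V, ∀ (m : Fin (7 - 1)) (a b : Fin 7), (a : ℕ) = m + 1 → (b : ℕ) = m →
        X a b = dm 1 (Matrix.of fun a b : Fin 7 => if (b : ℤ) - (a : ℤ) = (-1 : ℤ) then X a b else 0) m := by
      intro X hX m a b ha hb'
      rw [hdm 1 _ m a b ha hb', Matrix.of_apply, if_pos (by omega)]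
    have hXW : ∀ X ∈ V, (Matrix.of fun a b : Fin 7 => if (b : ℤ) - (a : ℤ) = (-1 : ℤ) then X a b else 0) ∈ W :=
      fun X hX => hinit X hX (-1) (fun a b hab => hbelow X hX a b (by omega))
    rcases forall_eq_zero_or_of_mul_eq_zero (W.map (dm 1)) _ _ hprod with h0 | h2
    · refine not_irreducible_of_column_strip V 0 (by norm_num) (fun X hX a b hb0 ha => ?_)
      by_cases hlt : (b : ℕ) + 1 < (a : ℕ)
      · exact hbelow X hX a b hlt
      · rw [hentry X hX ⟨0, by omega⟩ a b (show (a : ℕ) = 0 + 1 by omega) (show (b : ℕ) = 0 by omega)]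
        have := h0 _ ⟨_, hXW X hX, rfl⟩
        simpa only [LinearMap.coe_proj, Function.eval] using this
    · refine not_irreducible_of_column_strip V 2 (by norm_num) (fun X hX a b hb2 ha => ?_)
      by_cases hlt : (b : ℕ) + 1 < (a : ℕ)
      · exact hbelow X hX a b hlt
      · rw [hentry X hX ⟨2, by omega⟩ a b (show (a : ℕ) = 2 + 1 by omega) (show (b : ℕ) = 2 by omega)]
        have := h2 _ ⟨_, hXW X hX, rfl⟩
        simpa only [LinearMap.coe_proj, Function.eval] using this
  · -- lowest weight s = 2
    obtain ⟨c, hc⟩ : ∃ c : Fin 7 → ℂ, ∀ b : Fin 7, c b = if hb : (b : ℕ) < 7 - 2 then dm 2 B ⟨(b : ℕ), hb⟩ else 0 := ⟨_, fun _ => rfl⟩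
    have hc' : ∀ i : Fin (7 - 2), c ⟨(i : ℕ), by omega⟩ = dm 2 B i := fun i => by rw [hc, dif_pos i.isLt]
    have hYc : (Matrix.of fun a b : Fin 7 => if (a : ℕ) = (b : ℕ) + 2 then c b else 0) ∈ W := lower_band_mem W hgr 2 (dm 2) (hdm 2) B hB c hc'
    have hC : hstar ≠ 1 → (Matrix.of fun a b : Fin 7 => if (a : ℕ) = (b : ℕ) + 1 then (![c 0, c 0 + c 1, c 1 + c 2, c 2 + c 3, c 3 + c 4, c 4, 0] : Fin 7 → ℂ) b else 0) ∈ W := by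
      intro hne1
      obtain ⟨gsum, -⟩ := key 1 (by norm_num) (by norm_num) (Ne.symm hne1)
      have hortho : ∀ v ∈ W.map (dp 1), (fun k : Fin (7 - 1) => (![c 0, c 0 + c 1, c 1 + c 2, c 2 + c 3, c 3 + c 4, c 4, 0] : Fin 7 → ℂ) ⟨(k : ℕ), by omega⟩) ⬝ᵥ v = 0 := by
        rintro _ ⟨A, hA, rfl⟩
        obtain ⟨p, hp⟩ : ∃ p : Fin 7 → ℂ, ∀ a : Fin 7, p a = if ha : (a : ℕ) < 7 - 1 then dp 1 A ⟨(a : ℕ), ha⟩ else 0 := ⟨_, fun _ => rfl⟩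
        have hmix := trace_mixed_eq_zero_of_mem W hWnil hJW (hgr A hA 1) hYc 2
        have hZeq : (Matrix.of fun a b : Fin 7 => if (b : ℤ) - (a : ℤ) = (1 : ℤ) then A a b else 0) =
            (Matrix.of fun a b : Fin 7 => if (b : ℕ) = (a : ℕ) + 1 then p a else 0) := by
          ext a b
          simp only [Matrix.of_apply]
          by_cases hb : (b : ℕ) = (a : ℕ) + 1
          · rw [if_pos (by omega), if_pos hb, hp, dif_pos (by omega),
              hdp 1 A ⟨(a : ℕ), by omega⟩ a b rfl (show (b : ℕ) = (a : ℕ) + 1 by omega)]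
          · rw [if_neg (by omega), if_neg hb]
        rw [hZeq, window_2 c p, polyDot_2 c (dp 1 A) p hp] at hmix
        exact hmix
      obtain ⟨B', hB', hB'e⟩ := mem_of_dot_eq_zero (W.map (dp 1)) (W.map (dm 1)) (hPN 1) gsum _ hortho
      exact lower_band_mem W hgr 1 (dm 1) (hdm 1) B' hB' (![c 0, c 0 + c 1, c 1 + c 2, c 2 + c 3, c 3 + c 4, c 4, 0] : Fin 7 → ℂ) (fun i => by rw [hB'e])
    have hz := Summit.ValiantsHypothesis.ValiantsHypothesis.Theorems.GrenetZeon.HeavyTopThmCKillS2.kill hstar W hWnil c hYc hJW hJpow hUnit hC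
    exfalso
    apply hx0
    funext i
    have hi := hz ⟨(i : ℕ), by omega⟩ (show (i : ℕ) + 2 ≤ 6 by omega)
    rw [hc' i] at hi
    exact hi
  · -- lowest weight s = 3
    obtain ⟨c, hc⟩ : ∃ c : Fin 7 → ℂ, ∀ b : Fin 7, c b = if hb : (b : ℕ) < 7 - 3 then dm 3 B ⟨(b : ℕ), hb⟩ else 0 := ⟨_, fun _ => rfl⟩
    have hc' : ∀ i : Fin (7 - 3), c ⟨(i : ℕ), by omega⟩ = dm 3 B i := fun i => by rw [hc, dif_pos i.isLt]
    have hYc : (Matrix.of fun a b : Fin 7 => if (a : ℕ) = (b : ℕ) + 3 then c b else 0) ∈ W := lower_band_mem W hgr 3 (dm 3) (hdm 3) B hB c hc'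
    have hC : hstar ≠ 1 → (Matrix.of fun a b : Fin 7 => if (a : ℕ) = (b : ℕ) + 1 then (![c 0, c 0 + c 1, c 0 + c 1 + c 2, c 1 + c 2 + c 3, c 2 + c 3, c 3, 0] : Fin 7 → ℂ) b else 0) ∈ W := by
      intro hne1
      obtain ⟨gsum, -⟩ := key 1 (by norm_num) (by norm_num) (Ne.symm hne1)
      have hortho : ∀ v ∈ W.map (dp 1), (fun k : Fin (7 - 1) => (![c 0, c 0 + c 1, c 0 + c 1 + c 2, c 1 + c 2 + c 3, c 2 + c 3, c 3, 0] : Fin 7 → ℂ) ⟨(k : ℕ), by omega⟩) ⬝ᵥ v = 0 := by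
        rintro _ ⟨A, hA, rfl⟩
        obtain ⟨p, hp⟩ : ∃ p : Fin 7 → ℂ, ∀ a : Fin 7, p a = if ha : (a : ℕ) < 7 - 1 then dp 1 A ⟨(a : ℕ), ha⟩ else 0 := ⟨_, fun _ => rfl⟩
        have hmix := trace_mixed_eq_zero_of_mem W hWnil hJW (hgr A hA 1) hYc 3
        have hZeq : (Matrix.of fun a b : Fin 7 => if (b : ℤ) - (a : ℤ) = (1 : ℤ) then A a b else 0) =
            (Matrix.of fun a b : Fin 7 => if (b : ℕ) = (a : ℕ) + 1 then p a else 0) := by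
          ext a b
          simp only [Matrix.of_apply]
          by_cases hb : (b : ℕ) = (a : ℕ) + 1
          · rw [if_pos (by omega), if_pos hb, hp, dif_pos (by omega),
              hdp 1 A ⟨(a : ℕ), by omega⟩ a b rfl (show (b : ℕ) = (a : ℕ) + 1 by omega)]
          · rw [if_neg (by omega), if_neg hb]
        rw [hZeq, window_3 c p, polyDot_3 c (dp 1 A) p hp] at hmix
        exact hmix
      obtain ⟨B', hB', hB'e⟩ := mem_of_dot_eq_zero (W.map (dp 1)) (W.map (dm 1)) (hPN 1) gsum _ hortho
      exact lower_band_mem W hgr 1 (dm 1) (hdm 1) B' hB' (![c 0, c 0 + c 1, c 0 + c 1 + c 2, c 1 + c 2 + c 3, c 2 + c 3, c 3, 0] : Fin 7 → ℂ) (fun i => by rw [hB'e])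
    have hz := Summit.ValiantsHypothesis.ValiantsHypothesis.Theorems.GrenetZeon.HeavyTopThmCKillS3.kill hstar W hWnil c hYc hJW hJpow hUnit hC
    exfalso
    apply hx0
    funext i
    have hi := hz ⟨(i : ℕ), by omega⟩ (show (i : ℕ) + 3 ≤ 6 by omega)
    rw [hc' i] at hi
    exact hi
  · -- lowest weight s = 4
    obtain ⟨c, hc⟩ : ∃ c : Fin 7 → ℂ, ∀ b : Fin 7, c b = if hb : (b : ℕ) < 7 - 4 then dm 4 B ⟨(b : ℕ), hb⟩ else 0 := ⟨_, fun _ => rfl⟩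
    have hc' : ∀ i : Fin (7 - 4), c ⟨(i : ℕ), by omega⟩ = dm 4 B i := fun i => by rw [hc, dif_pos i.isLt]
    have hYc : (Matrix.of fun a b : Fin 7 => if (a : ℕ) = (b : ℕ) + 4 then c b else 0) ∈ W := lower_band_mem W hgr 4 (dm 4) (hdm 4) B hB c hc'
    have hC : hstar ≠ 1 → (Matrix.of fun a b : Fin 7 => if (a : ℕ) = (b : ℕ) + 1 then (![c 0, c 0 + c 1, c 0 + c 1 + c 2, c 0 + c 1 + c 2, c 1 + c 2, c 2, 0] : Fin 7 → ℂ) b else 0) ∈ W := by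
      intro hne1
      obtain ⟨gsum, -⟩ := key 1 (by norm_num) (by norm_num) (Ne.symm hne1)
      have hortho : ∀ v ∈ W.map (dp 1), (fun k : Fin (7 - 1) => (![c 0, c 0 + c 1, c 0 + c 1 + c 2, c 0 + c 1 + c 2, c 1 + c 2, c 2, 0] : Fin 7 → ℂ) ⟨(k : ℕ), by omega⟩) ⬝ᵥ v = 0 := by
        rintro _ ⟨A, hA, rfl⟩
        obtain ⟨p, hp⟩ : ∃ p : Fin 7 → ℂ, ∀ a : Fin 7, p a = if ha : (a : ℕ) < 7 - 1 then dp 1 A ⟨(a : ℕ), ha⟩ else 0 := ⟨_, fun _ => rfl⟩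
        have hmix := trace_mixed_eq_zero_of_mem W hWnil hJW (hgr A hA 1) hYc 4
        have hZeq : (Matrix.of fun a b : Fin 7 => if (b : ℤ) - (a : ℤ) = (1 : ℤ) then A a b else 0) =
            (Matrix.of fun a b : Fin 7 => if (b : ℕ) = (a : ℕ) + 1 then p a else 0) := by
          ext a b
          simp only [Matrix.of_apply]
          by_cases hb : (b : ℕ) = (a : ℕ) + 1
          · rw [if_pos (by omega), if_pos hb, hp, dif_pos (by omega),
              hdp 1 A ⟨(a : ℕ), by omega⟩ a b rfl (show (b : ℕ) = (a : ℕ) + 1 by omega)]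
          · rw [if_neg (by omega), if_neg hb]
        rw [hZeq, window_4 c p, polyDot_4 c (dp 1 A) p hp] at hmix
        exact hmix
      obtain ⟨B', hB', hB'e⟩ := mem_of_dot_eq_zero (W.map (dp 1)) (W.map (dm 1)) (hPN 1) gsum _ hortho
      exact lower_band_mem W hgr 1 (dm 1) (hdm 1) B' hB' (![c 0, c 0 + c 1, c 0 + c 1 + c 2, c 0 + c 1 + c 2, c 1 + c 2, c 2, 0] : Fin 7 → ℂ) (fun i => by rw [hB'e])
    have hz := Summit.ValiantsHypothesis.ValiantsHypothesis.Theorems.GrenetZeon.HeavyTopThmCKillS4.kill hstar W hWnil c hYc hJW hJpow hUnit hC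
    exfalso
    apply hx0
    funext i
    have hi := hz ⟨(i : ℕ), by omega⟩ (show (i : ℕ) + 4 ≤ 6 by omega)
    rw [hc' i] at hi
    exact hi
  · -- lowest weight s = 5
    obtain ⟨c, hc⟩ : ∃ c : Fin 7 → ℂ, ∀ b : Fin 7, c b = if hb : (b : ℕ) < 7 - 5 then dm 5 B ⟨(b : ℕ), hb⟩ else 0 := ⟨_, fun _ => rfl⟩
    have hc' : ∀ i : Fin (7 - 5), c ⟨(i : ℕ), by omega⟩ = dm 5 B i := fun i => by rw [hc, dif_pos i.isLt]
    have hYc : (Matrix.of fun a b : Fin 7 => if (a : ℕ) = (b : ℕ) + 5 then c b else 0) ∈ W := lower_band_mem W hgr 5 (dm 5) (hdm 5) B hB c hc'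
    have hC : hstar ≠ 1 → (Matrix.of fun a b : Fin 7 => if (a : ℕ) = (b : ℕ) + 1 then (![c 0, c 0 + c 1, c 0 + c 1, c 0 + c 1, c 0 + c 1, c 1, 0] : Fin 7 → ℂ) b else 0) ∈ W := by
      intro hne1
      obtain ⟨gsum, -⟩ := key 1 (by norm_num) (by norm_num) (Ne.symm hne1)
      have hortho : ∀ v ∈ W.map (dp 1), (fun k : Fin (7 - 1) => (![c 0, c 0 + c 1, c 0 + c 1, c 0 + c 1, c 0 + c 1, c 1, 0] : Fin 7 → ℂ) ⟨(k : ℕ), by omega⟩) ⬝ᵥ v = 0 := by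
        rintro _ ⟨A, hA, rfl⟩
        obtain ⟨p, hp⟩ : ∃ p : Fin 7 → ℂ, ∀ a : Fin 7, p a = if ha : (a : ℕ) < 7 - 1 then dp 1 A ⟨(a : ℕ), ha⟩ else 0 := ⟨_, fun _ => rfl⟩
        have hmix := trace_mixed_eq_zero_of_mem W hWnil hJW (hgr A hA 1) hYc 5
        have hZeq : (Matrix.of fun a b : Fin 7 => if (b : ℤ) - (a : ℤ) = (1 : ℤ) then A a b else 0) =
            (Matrix.of fun a b : Fin 7 => if (b : ℕ) = (a : ℕ) + 1 then p a else 0) := by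
          ext a b
          simp only [Matrix.of_apply]
          by_cases hb : (b : ℕ) = (a : ℕ) + 1
          · rw [if_pos (by omega), if_pos hb, hp, dif_pos (by omega),
              hdp 1 A ⟨(a : ℕ), by omega⟩ a b rfl (show (b : ℕ) = (a : ℕ) + 1 by omega)]
          · rw [if_neg (by omega), if_neg hb]
        rw [hZeq, window_5 c p, polyDot_5 c (dp 1 A) p hp] at hmix
        exact hmix
      obtain ⟨B', hB', hB'e⟩ := mem_of_dot_eq_zero (W.map (dp 1)) (W.map (dm 1)) (hPN 1) gsum _ hortho
      exact lower_band_mem W hgr 1 (dm 1) (hdm 1) B' hB' (![c 0, c 0 + c 1, c 0 + c 1, c 0 + c 1, c 0 + c 1, c 1, 0] : Fin 7 → ℂ) (fun i => by rw [hB'e])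
    have hz := Summit.ValiantsHypothesis.ValiantsHypothesis.Theorems.GrenetZeon.HeavyTopThmCKillS5.kill hstar W hWnil c hYc hJW hJpow hUnit hC
    exfalso
    apply hx0
    funext i
    have hi := hz ⟨(i : ℕ), by omega⟩ (show (i : ℕ) + 5 ≤ 6 by omega)
    rw [hc' i] at hi
    exact hi

/-- ★★★ **THEOREM C(7).**  Every `20`-dimensional linear space of nilpotent `7 × 7` complex matrices containing a regular nilpotent (`Z^6 ≠ 0`) has a
non-trivial proper invariant subspace — verbatim the hypothesis `hC7` of ✓ `HeavyTopIotaOfThmC.heavyTopInst_five_seven_of_thmC7`.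
[lead g0 ROADMAP-codim1 Thm C(7) (pencil) + lead-g2 THMC-CHECK (machine); this seat: kernel] -/
theorem thmC7 : ∀ V : Submodule ℂ (Matrix (Fin 7) (Fin 7) ℂ), (∀ A ∈ V, IsNilpotent A) → Module.finrank ℂ V = 20 →
    (∃ Z ∈ V, Z ^ 6 ≠ 0) → ¬ ∀ U : Submodule ℂ (Fin 7 → ℂ), (∀ A ∈ V, ∀ x ∈ U, A *ᵥ x ∈ U) → U = ⊥ ∨ U = ⊤ := by
  intro V hV hdim hZ
  obtain ⟨Z, hZV, hZ6⟩ := hZ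
  have hZ7 : Z ^ 7 = 0 := pow_eq_zero_of_isNilpotent Z (hV Z hZV)
  obtain ⟨P, hP, hPZ⟩ := exists_isUnit_conj_eq_fullShift (m := 6) Z hZ7 hZ6
  obtain ⟨V', hV'dim, hVV', -, -, hV'pow⟩ := exists_conj_subspace P hP V
  have hV'nil : ∀ A ∈ V', IsNilpotent A := fun A hA =>
    ⟨7, hV'pow 7 (fun Z hZ => pow_eq_zero_of_isNilpotent Z (hV Z hZ)) A hA⟩
  have hJ : (Matrix.of fun a b : Fin 7 => if (b : ℕ) = (a : ℕ) + 1 then (1 : ℂ) else 0) ∈ V' := by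
    rw [← hPZ]; exact hVV' Z hZV
  exact not_irreducible_of_conj P hP V V' hVV' (thmC7_shift V' hV'nil (hV'dim.trans hdim) hJ)

/-- ★★★ **The census cell `(5,7)` is TRUE in the kernel**: `HeavyTopInst 5 7` (every affine nilpotent `7 × 7` pencil over `ℂ^{5×5}` is flag-cheap at
budget `n = 5`), with NO hypothesis. [✓ `heavyTopInst_five_seven_of_thmC7` ∘ `thmC7`] -/
theorem heavyTopInst_five_seven : HeavyTopInst 5 7 :=
  heavyTopInst_five_seven_of_thmC7 thmC7

/-- **`ι(7) ≤ 19` in the kernel**: every irreducible linear space of nilpotent `7 × 7` complex matrices has dimension `≤ 19`. [✓ `iota7_of_thmC7` ∘ `thmC7`] -/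
theorem iota_seven_le_nineteen : ∀ V : Submodule ℂ (Matrix (Fin 7) (Fin 7) ℂ), (∀ A ∈ V, IsNilpotent A) →
    (∀ U : Submodule ℂ (Fin 7 → ℂ), (∀ A ∈ V, ∀ x ∈ U, A *ᵥ x ∈ U) → U = ⊥ ∨ U = ⊤) → Module.finrank ℂ V ≤ 19 :=
  iota7_of_thmC7 thmC7

/-- **Row `n = 5` up to `m = 7`**: `HeavyTopInst 5 m` for all `m ≤ 7` (band for `m ≤ 6`, ✓ `heavyTopInst_five_seven` at `7`). [this seat] -/
theorem heavyTopInst_five_of_le_seven {m : ℕ} (hm : m ≤ 7) : HeavyTopInst 5 m := by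
  rcases Nat.lt_or_ge m 7 with h | h
  · refine Summit.ValiantsHypothesis.ValiantsHypothesis.Theorems.GrenetZeon.RadicalSplit.heavyTopInst_of_choose_two_add_lt ?_
    interval_cases m <;> decide
  · rw [show m = 7 by omega]; exact heavyTopInst_five_seven

end Summit.ValiantsHypothesis.ValiantsHypothesis.Theorems.GrenetZeon.HeavyTopThmCSeven

end
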